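import Literature.Probability.LatticeModels.FieldCurrentsClusters
import Literature.Probability.LatticeModels.EdgeSetWalk
import HarnessLib

/-!
# The backbone kernel `K(v,k)`: supermodularity, the avoidance bound and `K ≤ ⟨σσ⟩_{h=0}`

Topic `Probability/LatticeModels`, namespace `Literature.Probability.LatticeModels`. Fourth layer of the
proof of the Aizenman–Fernández differential inequalities (J. Stat. Phys. 44 (1986) 393–454): the
random-walk (backbone) representation of §4 in the high-temperature picture, for the `θ`-system of
`FieldCurrentsTheta` on the edges `ℰ⁺_Λ` of the ghost graph (weights `∏_F tanh θ_e`, sums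
`ghteSum`), driven by the deterministic exploration `ewRun` of `EdgeSetWalk`.

* Part A. High-temperature algebra: splitting `g_{E'}(B)` at an edge, the depleted sums
  `g_{ℰ⁺ ∖ D}` as the sums of `cplOff θ D`, and the **supermodularity of `E' ↦ log g_{E'}(∅)`**
  (`ghteSum_empty_supermodular`: `g_{X∖A}(∅) g_{X∖B}(∅) ≤ g_{X∖(A∪B)}(∅) g_X(∅)`), which is
  Aizenman–Fernández's Claim (4.15) ("there is a smaller effect in the latter case"), proved from
  Griffiths II one edge at a time.
* Part B. The walk on `ℰ⁺_Λ`: the outcome of the walk characterises the edge set on the cancelled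
  pairs (locality), and the **avoidance bound** `sum_tw_avoid_le` (the mechanism of Prop. 4.4
  (e)–(f), eqs. (4.11)–(4.13) with Claim (4.15)): continuations of a walk that avoid a vertex set `C`
  weigh at most `g_{ℰ⁺∖U}(∅) g_{ℰ⁺∖(U∪D)}(B)/g_{ℰ⁺∖(U∪D)}(∅)`, `D` the pairs at `C`, `U` the pairs
  already cancelled.
* Part C. **The kernel** `bbKernel θ v k = K(v,k)` (Definition 4.5, eq. (4.16): the weight of the
  edge sets with odd vertices `{v,k}` whose backbone from `v` reaches `k` before the ghost) and
  **Prop. 4.7, right half of (4.22)**: `K(v,k) ≤ ⟨σ_vσ_k⟩_{h=0}`.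

Lemma 5.5 (the effect of removing a cluster) is derived from these in `ClusterDeficit`.
Everything is proved; there are no named facts.

## References

* M. Aizenman, R. Fernández, J. Stat. Phys. 44 (1986) 393–454: §4.1–4.3 (Defs. 4.1–4.5,
  Prop. 4.4 (a)–(f) with Claim (4.15), Prop. 4.6 (4.21), Prop. 4.7 (4.22)), §5.1 (Lemma 5.5,
  eqs. (5.15)–(5.18)) [AizenmanFernandezJSP1986] (held: `paper:url-b8cebc3f44bb`).
-/

noncomputable section

open Finset MeasureTheory
open scoped symmDiff ENNReal

namespace Literature.Probability.LatticeModels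

variable {V : Type*} [DecidableEq V]

section Backbone

variable {G : SimpleGraph V} [G.LocallyFinite] {Λ : Finset V}

local notation "Gg" => ghostGraph G Λ
local notation "Λg" => Finset.insertNone Λ
local notation "Eg" => edgesIn (ghostGraph G Λ) (Finset.insertNone Λ)
local notation "gS[" θ ", " E' ", " B "]" => ghteSum (Finset.insertNone Λ) θ E' B

/-! ## Part A. High-temperature algebra -/

/-- The weight `∏_{e ∈ F} tanh θ_e` of an edge set. [cite: AizenmanFernandezJSP1986, §4.1, eq. (4.4)] -/
def tw (θ : Sym2 (Option V) → ℝ) (F : Finset (Sym2 (Option V))) : ℝ := ∏ e ∈ F, Real.tanh (θ e)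

omit [DecidableEq V] in
/-- `tw ≥ 0` for `θ ≥ 0`. [folklore] -/
theorem tw_nonneg {θ : Sym2 (Option V) → ℝ} (hθ : ∀ e, 0 ≤ θ e) (F : Finset (Sym2 (Option V))) : 0 ≤ tw θ F :=
  prod_nonneg fun e _ => Literature.Probability.LatticeModels.tanh_nonneg (hθ e)

/-- `tw (insert e F) = tanh θ_e · tw F` for `e ∉ F`. [folklore] -/
theorem tw_insert {θ : Sym2 (Option V) → ℝ} {F : Finset (Sym2 (Option V))} {e : Sym2 (Option V)} (he : e ∉ F) :
    tw θ (insert e F) = Real.tanh (θ e) * tw θ F := prod_insert he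

/-- `tw` of a disjoint union. [folklore] -/
theorem tw_union {θ : Sym2 (Option V) → ℝ} {A B : Finset (Sym2 (Option V))} (h : Disjoint A B) :
    tw θ (A ∪ B) = tw θ A * tw θ B := prod_union h

/-- `g_{E'}(B)` as a sum of weights `tw`. [folklore] -/
theorem ghteSum_eq_sum_tw (θ : Sym2 (Option V) → ℝ) (E' : Finset (Sym2 (Option V))) (B : Finset (Option V)) :
    gS[θ, E', B] = ∑ F ∈ E'.powerset with oddVerts Λg F = B, tw θ F := rfl

/-- Edges of the ghost graph inside `Λ ∪ {g}` are not diagonal. [folklore] -/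
theorem not_isDiag_of_mem_edgesIn_ghost {e : Sym2 (Option V)} (he : e ∈ Eg) : ¬e.IsDiag :=
  (ghostGraph G Λ).not_isDiag_of_mem_edgeSet (mem_edgesIn_iff.1 he).1

/-- The degree parities of a disjoint union add: `∂(A ∪ B) = ∂A ∆ ∂B`. [folklore] -/
theorem oddVerts_union_of_disjoint {W : Type*} [DecidableEq W] (Λ' : Finset W) {A B : Finset (Sym2 W)}
    (h : Disjoint A B) : oddVerts Λ' (A ∪ B) = oddVerts Λ' A ∆ oddVerts Λ' B := by
  ext v
  simp only [oddVerts, mem_filter, mem_symmDiff]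
  rw [filter_union, card_union_of_disjoint (disjoint_filter_filter h), Nat.odd_add, ← Nat.not_odd_iff_even]
  by_cases hv : v ∈ Λ'
  · simp only [hv, true_and]; tauto
  · simp only [hv, false_and, or_self]

/-- **Splitting `g_{E'}(B)` at an edge** `e = {a,b} ∈ E'` (`a ≠ b` in `Λ ∪ {g}`):
`g_{E'}(B) = g_{E'∖e}(B) + tanh θ_e · g_{E'∖e}(B ∆ {a,b})` (edge sets containing `e` or not;
adding `e` toggles the parities of its endpoints). [cite: AizenmanFernandezJSP1986, §4.3, proof of Prop. 4.6 ("splitting from the paths their last step")] -/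
theorem ghteSum_split {θ : Sym2 (Option V) → ℝ} {E' : Finset (Sym2 (Option V))} {a b : Option V}
    (ha : a ∈ Λg) (hb : b ∈ Λg) (he : s(a, b) ∈ E') (B : Finset (Option V)) :
    gS[θ, E', B] = gS[θ, E'.erase s(a, b), B] + Real.tanh (θ s(a, b)) * gS[θ, E'.erase s(a, b), B ∆ {a, b}] := by
  have hcancel : ∀ X : Finset (Option V), (X ∆ {a, b}) ∆ {a, b} = X := fun X => by
    rw [symmDiff_assoc, symmDiff_self, symmDiff_bot]
  rw [ghteSum_eq_sum_tw, ghteSum_eq_sum_tw, ghteSum_eq_sum_tw,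
    ← sum_filter_add_sum_filter_not _ (fun F => s(a, b) ∉ F)]
  congr 1
  · apply sum_congr
    · ext F
      simp only [mem_filter, mem_powerset]
      constructor
      · rintro ⟨⟨hFE, hodd⟩, heF⟩
        exact ⟨fun f hf => mem_erase.2 ⟨fun h => heF (h ▸ hf), hFE hf⟩, hodd⟩
      · rintro ⟨hFE, hodd⟩
        exact ⟨⟨hFE.trans (erase_subset _ _), hodd⟩, fun h => (mem_erase.1 (hFE h)).1 rfl⟩
    · intro F _; rfl
  · -- the sets containing `e` are `insert e F'`, `F' ⊆ E' ∖ e`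
    rw [mul_sum]
    symm
    refine sum_nbij' (fun F' => insert s(a, b) F') (fun F => F.erase s(a, b)) ?_ ?_ ?_ ?_ ?_
    · intro F' hF'
      obtain ⟨hF'E, hodd⟩ := mem_filter.1 hF'
      rw [mem_powerset] at hF'E
      have heF' : s(a, b) ∉ F' := fun h => (mem_erase.1 (hF'E h)).1 rfl
      simp only [mem_filter, mem_powerset, not_not, mem_insert, true_or, and_true]
      refine ⟨insert_subset he (hF'E.trans (erase_subset _ _)), ?_⟩
      rw [oddVerts_insert ha hb heF', hodd, hcancel]
    · intro F hF
      simp only [mem_filter, mem_powerset, not_not] at hF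
      obtain ⟨⟨hFE, hodd⟩, heF⟩ := hF
      rw [mem_filter, mem_powerset]
      refine ⟨fun x hx => mem_erase.2 ⟨(mem_erase.1 hx).1, hFE (mem_erase.1 hx).2⟩, ?_⟩
      have heF' : s(a, b) ∉ F.erase s(a, b) := fun h => (mem_erase.1 h).1 rfl
      have h1 := oddVerts_insert (Λ := Λg) ha hb heF'
      rw [insert_erase heF, hodd] at h1
      rw [h1, hcancel]
    · intro F' hF'
      obtain ⟨hF'E, -⟩ := mem_filter.1 hF'
      rw [mem_powerset] at hF'E
      exact erase_insert fun h => (mem_erase.1 (hF'E h)).1 rfl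
    · intro F hF
      simp only [mem_filter, mem_powerset, not_not] at hF
      exact insert_erase hF.2
    · intro F' hF'
      obtain ⟨hF'E, -⟩ := mem_filter.1 hF'
      rw [mem_powerset] at hF'E
      exact (tw_insert fun h => (mem_erase.1 (hF'E h)).1 rfl).symm

/-- Sub-sums: `g_{E''}(B) ≤ g_{E'}(B)` for `E'' ⊆ E'` and `θ ≥ 0`. [folklore] -/
theorem ghteSum_mono {θ : Sym2 (Option V) → ℝ} (hθ : ∀ e, 0 ≤ θ e) {E'' E' : Finset (Sym2 (Option V))}
    (h : E'' ⊆ E') (B : Finset (Option V)) : gS[θ, E'', B] ≤ gS[θ, E', B] := by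
  rw [ghteSum_eq_sum_tw, ghteSum_eq_sum_tw]
  refine sum_le_sum_of_subset_of_nonneg (fun F hF => ?_) fun F _ _ => tw_nonneg hθ F
  rw [mem_filter, mem_powerset] at hF ⊢
  exact ⟨hF.1.trans h, hF.2⟩

/-- `g_{E'}(∅) ≥ 1` (the empty edge set) for `θ ≥ 0`. [folklore] -/
theorem one_le_ghteSum_empty {θ : Sym2 (Option V) → ℝ} (hθ : ∀ e, 0 ≤ θ e) (E' : Finset (Sym2 (Option V))) :
    1 ≤ gS[θ, E', ∅] := by
  rw [ghteSum_eq_sum_tw]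
  have h0 : (∅ : Finset (Sym2 (Option V))) ∈ E'.powerset.filter (fun F => oddVerts Λg F = ∅) := by
    rw [mem_filter, mem_powerset]; exact ⟨empty_subset _, oddVerts_empty _⟩
  calc (1 : ℝ) = tw θ ∅ := by simp [tw]
    _ ≤ _ := single_le_sum (f := tw θ) (fun F _ => tw_nonneg hθ F) h0

/-- `g_{E'}(∅) > 0` for `θ ≥ 0`. [folklore] -/
theorem ghteSum_empty_pos {θ : Sym2 (Option V) → ℝ} (hθ : ∀ e, 0 ≤ θ e) (E' : Finset (Sym2 (Option V))) :
    0 < gS[θ, E', ∅] :=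
  lt_of_lt_of_le zero_lt_one (one_le_ghteSum_empty hθ E')

/-- **The sums of the switched-off couplings are the sums off the switched-off edges**:
`g_{E'}^{cplOff θ D}(B) = g_{E' ∖ D}^θ(B)` (`tanh 0 = 0` kills every edge set meeting `D`). [cite: AizenmanFernandezJSP1986, §3.3, conventions after eq. (3.10)] -/
theorem ghteSum_cplOff (θ : Sym2 (Option V) → ℝ) (E' D : Finset (Sym2 (Option V))) (B : Finset (Option V)) :
    gS[cplOff θ D, E', B] = gS[θ, E' \ D, B] := by
  rw [ghteSum_eq_sum_tw, ghteSum_eq_sum_tw]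
  have hsub : (E' \ D).powerset.filter (fun F => oddVerts Λg F = B) ⊆ E'.powerset.filter (fun F => oddVerts Λg F = B) := by
    intro F hF
    rw [mem_filter, mem_powerset] at hF ⊢
    exact ⟨hF.1.trans sdiff_subset, hF.2⟩
  have hzero : ∀ F ∈ E'.powerset.filter (fun F => oddVerts Λg F = B),
      F ∉ (E' \ D).powerset.filter (fun F => oddVerts Λg F = B) → tw (cplOff θ D) F = 0 := by
    intro F hF hF'
    rw [mem_filter, mem_powerset] at hF hF'
    obtain ⟨e, heF, heD⟩ : ∃ e ∈ F, e ∈ D := by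
      by_contra hcon
      simp only [not_exists, not_and] at hcon
      exact hF' ⟨fun e he => mem_sdiff.2 ⟨hF.1 he, hcon e he⟩, hF.2⟩
    exact prod_eq_zero heF (by rw [cplOff_of_mem heD, Real.tanh_zero])
  rw [← sum_subset hsub hzero]
  refine sum_congr rfl fun F hF => ?_
  rw [mem_filter, mem_powerset] at hF
  exact prod_congr rfl fun e he => by rw [cplOff_of_not_mem (mem_sdiff.1 (hF.1 he)).2]

/-- **Depleted correlations as ratios of high-temperature sums**: for `E' ⊆ ℰ⁺_Λ` and `A ⊆ Λ`,
`⟨σ_A⟩_{cplOff θ (ℰ⁺ ∖ E')} = g_{E'}(A*)/g_{E'}(∅)`. [cite: AizenmanFernandezJSP1986, §4.2, eq. (4.13)] -/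
theorem thetaCorr_cplOff_sdiff_eq_ghteSum_div (θ : Sym2 (Option V) → ℝ) {E' : Finset (Sym2 (Option V))}
    (hE' : E' ⊆ Eg) {A : Finset V} (hA : A ⊆ Λ) :
    thetaCorr G Λ (cplOff θ (Eg \ E')) A = gS[θ, E', starSet A] / gS[θ, E', ∅] := by
  rw [thetaCorr_eq_ghteSum_div _ hA, ghteSum_cplOff, ghteSum_cplOff, Finset.sdiff_sdiff_eq_self hE']

/-- **Griffiths II for edge sets**: the pair ratio `g_{E''}(∂e)/g_{E''}(∅)` is monotone in `E'' ⊆ ℰ⁺_Λ`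
(`∂e = {a,b}` the endpoints of an edge `e` of the ghost graph, i.e. a correlation `⟨σ_aσ_b⟩` or
`⟨σ_a⟩`, in the system with the other edges switched off). [cite: FriedliVelenik2017, Exercise 3.31, p. 142] -/
theorem ghteSum_pair_ratio_mono {θ : Sym2 (Option V) → ℝ} (hθ : ∀ e, 0 ≤ θ e) {E'' E' : Finset (Sym2 (Option V))}
    (h'' : E'' ⊆ E') (hE' : E' ⊆ Eg) {e : Sym2 (Option V)} (he : e ∈ Eg) :
    gS[θ, E'', (Λg).filter (· ∈ e)] / gS[θ, E'', ∅] ≤ gS[θ, E', (Λg).filter (· ∈ e)] / gS[θ, E', ∅] := by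
  -- identify `Λg.filter (· ∈ e)` with a source set `A*`, `A ⊆ Λ`
  obtain ⟨A, hAΛ, hAe⟩ : ∃ A : Finset V, A ⊆ Λ ∧ starSet A = (Λg).filter (· ∈ e) := by
    rw [edgesIn_ghostGraph_insertNone subset_rfl, mem_union, mem_map, mem_map] at he
    rcases he with ⟨e₀, he₀, rfl⟩ | ⟨x, hx, rfl⟩
    · induction e₀ using Sym2.ind with
      | _ x y =>
        obtain ⟨hadj, hmem⟩ := mem_edgesIn_iff.1 he₀
        have hxy : x ≠ y := G.ne_of_adj ((SimpleGraph.mem_edgeSet G).1 hadj)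
        refine ⟨{x} ∆ {y}, symmDiff_le_sup.trans (sup_le (singleton_subset_iff.2 (hmem x (Sym2.mem_mk_left x y)))
          (singleton_subset_iff.2 (hmem y (Sym2.mem_mk_right x y)))), ?_⟩
        rw [starSet_pair, liftEdge_mk]
        ext v
        simp only [mem_symmDiff, mem_singleton, mem_filter, Sym2.mem_iff]
        constructor
        · rintro (⟨rfl, -⟩ | ⟨rfl, -⟩)
          · exact ⟨Finset.some_mem_insertNone.2 (hmem x (Sym2.mem_mk_left x y)), Or.inl rfl⟩
          · exact ⟨Finset.some_mem_insertNone.2 (hmem y (Sym2.mem_mk_right x y)), Or.inr rfl⟩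
        · rintro ⟨-, rfl | rfl⟩
          · exact Or.inl ⟨rfl, fun h => hxy (Option.some_injective _ h)⟩
          · exact Or.inr ⟨rfl, fun h => hxy (Option.some_injective _ h).symm⟩
    · refine ⟨{x}, singleton_subset_iff.2 hx, ?_⟩
      rw [starSet_singleton, ghostEdge_apply]
      ext v
      simp only [mem_symmDiff, mem_singleton, mem_filter, Sym2.mem_iff]
      constructor
      · rintro (⟨rfl, -⟩ | ⟨rfl, -⟩)
        · exact ⟨Finset.some_mem_insertNone.2 hx, Or.inl rfl⟩
        · exact ⟨Finset.mem_insertNone.2 (by simp), Or.inr rfl⟩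
      · rintro ⟨-, rfl | rfl⟩
        · exact Or.inl ⟨rfl, fun h => Option.some_ne_none x h⟩
        · exact Or.inr ⟨rfl, fun h => Option.some_ne_none x h.symm⟩
  rw [← hAe, ← thetaCorr_cplOff_sdiff_eq_ghteSum_div θ (h''.trans hE') hAΛ,
    ← thetaCorr_cplOff_sdiff_eq_ghteSum_div θ hE' hAΛ]
  exact thetaCorr_cplOff_anti hθ (sdiff_subset_sdiff subset_rfl h'') hAΛ

/-- One edge: the ratio `g_{X∖A}(∅)/g_X(∅)` does not decrease when an edge is removed from `X ⊆ ℰ⁺_Λ`. [cite: AizenmanFernandezJSP1986, §4.2, Claim (4.15)] -/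
theorem ghteSum_ratio_erase_ge {θ : Sym2 (Option V) → ℝ} (hθ : ∀ e, 0 ≤ θ e) {X : Finset (Sym2 (Option V))}
    (hX : X ⊆ Eg) (A : Finset (Sym2 (Option V))) (e : Sym2 (Option V)) :
    gS[θ, X \ A, ∅] / gS[θ, X, ∅] ≤ gS[θ, (X.erase e) \ A, ∅] / gS[θ, X.erase e, ∅] := by
  by_cases heX : e ∈ X
  swap
  · rw [erase_eq_of_notMem heX]
  have hpos : ∀ Y : Finset (Sym2 (Option V)), 0 < gS[θ, Y, ∅] := fun Y => ghteSum_empty_pos hθ Y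
  by_cases heA : e ∈ A
  · -- `e ∈ A`: numerators agree, denominators decrease
    have h1 : (X.erase e) \ A = X \ A := by
      ext f; simp only [mem_sdiff, mem_erase]
      constructor
      · rintro ⟨⟨-, hf⟩, hfA⟩; exact ⟨hf, hfA⟩
      · rintro ⟨hf, hfA⟩; exact ⟨⟨fun h => hfA (h ▸ heA), hf⟩, hfA⟩
    rw [h1]
    exact div_le_div_of_nonneg_left (ghteSum_nonneg hθ _ _) (hpos _) (ghteSum_mono hθ (erase_subset _ _) _)
  · -- `e ∉ A`: split both sums at `e`
    have heE : e ∈ Eg := hX heX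
    induction e using Sym2.ind with
    | _ a b =>
      obtain ⟨hadj, hmem⟩ := mem_edgesIn_iff.1 heE
      have hab : a ≠ b := (ghostGraph G Λ).ne_of_adj ((SimpleGraph.mem_edgeSet _).1 hadj)
      have ha : a ∈ Λg := hmem a (Sym2.mem_mk_left a b)
      have hb : b ∈ Λg := hmem b (Sym2.mem_mk_right a b)
      have heXA : s(a, b) ∈ X \ A := mem_sdiff.2 ⟨heX, heA⟩
      rw [ghteSum_split ha hb heX, ghteSum_split ha hb heXA]
      have hXe : (X \ A).erase s(a, b) = (X.erase s(a, b)) \ A := by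
        ext f; simp only [mem_erase, mem_sdiff]; tauto
      rw [hXe]
      set t := Real.tanh (θ s(a, b)) with ht
      have ht0 : 0 ≤ t := Literature.Probability.LatticeModels.tanh_nonneg (hθ _)
      set P := ((Λg).filter (· ∈ s(a, b))) with hP
      have hPab : (∅ : Finset (Option V)) ∆ {a, b} = P := by
        rw [show (∅ : Finset (Option V)) ∆ {a, b} = {a, b} from bot_symmDiff _, hP]
        ext v; simp only [mem_insert, mem_singleton, mem_filter, Sym2.mem_iff]
        constructor
        · rintro (rfl | rfl)
          · exact ⟨ha, Or.inl rfl⟩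
          · exact ⟨hb, Or.inr rfl⟩
        · rintro ⟨-, h⟩; exact h
      rw [hPab]
      set Y := (X.erase s(a, b)) \ A with hY
      set Y' := X.erase s(a, b) with hY'
      have hYY' : Y ⊆ Y' := sdiff_subset
      have hY'E : Y' ⊆ Eg := (erase_subset _ _).trans hX
      -- `c(Y) ≤ c(Y')` for the pair ratios
      have hc := ghteSum_pair_ratio_mono hθ hYY' hY'E heE
      rw [← hP] at hc
      have h0 := hpos Y
      have h0' := hpos Y'
      rw [div_le_div_iff₀ h0 h0'] at hc
      have hnum : 0 ≤ gS[θ, Y, P] := ghteSum_nonneg hθ _ _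
      have hnum' : 0 ≤ gS[θ, Y', P] := ghteSum_nonneg hθ _ _
      have hden' : 0 < gS[θ, Y', ∅] + t * gS[θ, Y', P] := by positivity
      rw [div_le_div_iff₀ hden' h0']
      nlinarith [mul_le_mul_of_nonneg_left hc ht0, h0, h0']

/-- **Supermodularity of `E' ↦ log g_{E'}(∅)`** (Aizenman–Fernández 1986, Claim (4.15):
`Z_A/Z ≤ Z_{(A∪A')ᶜ}/Z_{A'ᶜ}`, "there is a smaller effect in the latter case"; equivalently the
super-multiplicativity `z(B ∪ B') ≥ z(B) z(B')` of Aizenman 1982, Lemma 9.3): for `X ⊆ ℰ⁺_Λ`,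
`θ ≥ 0` and any edge sets `A`, `B`,
`g_{X∖A}(∅) · g_{X∖B}(∅) ≤ g_{X∖(A∪B)}(∅) · g_X(∅)`. [cite: AizenmanFernandezJSP1986, §4.2, Claim (4.15)] -/
theorem ghteSum_empty_supermodular {θ : Sym2 (Option V) → ℝ} (hθ : ∀ e, 0 ≤ θ e) {X : Finset (Sym2 (Option V))}
    (hX : X ⊆ Eg) (A B : Finset (Sym2 (Option V))) :
    gS[θ, X \ A, ∅] * gS[θ, X \ B, ∅] ≤ gS[θ, X \ (A ∪ B), ∅] * gS[θ, X, ∅] := by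
  -- the ratio `g_{Y∖A}/g_Y` increases as the edges of `B` are removed from `Y = X`
  have key : ∀ (B' : Finset (Sym2 (Option V))),
      gS[θ, X \ A, ∅] / gS[θ, X, ∅] ≤ gS[θ, (X \ B') \ A, ∅] / gS[θ, X \ B', ∅] := by
    intro B'
    induction B' using Finset.induction_on with
    | empty => simp
    | insert e B' heB' ih =>
      have hXB : X \ B' ⊆ Eg := sdiff_subset.trans hX
      have h1 := ghteSum_ratio_erase_ge hθ hXB A e
      have h2 : (X \ B').erase e = X \ insert e B' := by
        ext f; simp only [mem_erase, mem_sdiff, mem_insert]; tauto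
      rw [h2] at h1
      exact ih.trans h1
  have h := key B
  have hXBA : (X \ B) \ A = X \ (A ∪ B) := by
    ext f; simp only [mem_sdiff, mem_union]; tauto
  rw [hXBA] at h
  have h0 := ghteSum_empty_pos (Λ := Λ) hθ X
  have h0' := ghteSum_empty_pos (Λ := Λ) hθ (X \ B)
  rw [div_le_div_iff₀ h0 h0'] at h
  linarith [h]

/-! ## Part B. The walk on `ℰ⁺_Λ`: outcomes, fibres and the avoidance bound -/

/-- States of the walk over `Λ ∪ {g}` have decidable equality. [folklore] -/
instance instDecidableEqEWState : DecidableEq (EWState (Option V)) := fun σ τ =>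
  decidable_of_iff (σ.pos = τ.pos ∧ σ.used = τ.used ∧ σ.trav = τ.trav ∧ σ.halt = τ.halt)
    ⟨fun h => by cases σ; cases τ; simp only [EWState.mk.injEq]; exact h, fun h => by subst h; simp⟩

variable (rk : Sym2 (Option V) → ℕ)

/-- **Newly traversed pairs were uncancelled**: the pairs traversed after time `n₀` lie in `ℰ⁺_Λ`
off the pairs cancelled at time `n₀`. [folklore] -/
theorem trav_sdiff_subset (F : Finset (Sym2 (Option V))) (T : Finset (Option V)) (v₀ : Option V)
    (n₀ n : ℕ) :
    (ewIter Eg rk F T (ewInit v₀) n).trav \ (ewIter Eg rk F T (ewInit v₀) n₀).trav ⊆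
      Eg \ (ewIter Eg rk F T (ewInit v₀) n₀).used := by
  induction n with
  | zero =>
    intro e he
    rw [mem_sdiff] at he
    exact absurd (trav_mono_ewIter F T (ewInit v₀) (Nat.zero_le n₀) he.1) he.2
  | succ n ih =>
    intro e he
    rw [mem_sdiff] at he ⊢
    set σ := ewIter Eg rk F T (ewInit v₀) n with hσ
    rw [ewIter_succ, ← hσ] at he
    rcases ewStep_cases (E := Eg) (rk := rk) F T σ with ⟨-, hs⟩ | ⟨-, -, hs⟩ | ⟨hh, hT, hA, hs⟩ | ⟨-, -, -, hs⟩
    · rw [hs] at he; exact mem_sdiff.1 (ih (mem_sdiff.2 he))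
    · rw [hs] at he; exact mem_sdiff.1 (ih (mem_sdiff.2 he))
    · obtain ⟨hstep, heE, -, heU, -, -⟩ := ewStep_traverse_spec (E := Eg) (rk := rk) hh hT hA
      rw [hstep] at he
      simp only [ewAdvance, mem_insert] at he
      rcases he.1 with rfl | he1
      · refine ⟨heE, fun hU => heU ?_⟩
        -- cancelled at time `n₀` means cancelled at time `n` (if `n₀ ≤ n`), else traversed edges
        -- at time `n+1` contain those of time `n₀ ≥ n+1`, contradicting `he.2`
        by_cases hle : n₀ ≤ n
        · exact used_mono_ewIter (E := Eg) (rk := rk) F T (ewInit v₀) hle hU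
        · exfalso
          rw [not_le] at hle
          have h1 : (ewIter Eg rk F T (ewInit v₀) (n + 1)).trav ⊆ (ewIter Eg rk F T (ewInit v₀) n₀).trav :=
            trav_mono_ewIter F T (ewInit v₀) hle
          refine he.2 (h1 ?_)
          rw [ewIter_succ, ← hσ, hstep]
          simp [ewAdvance]
      · exact mem_sdiff.1 (ih (mem_sdiff.2 ⟨he1, he.2⟩))
    · rw [hs] at he
      simp only [ewStuck] at he
      exact mem_sdiff.1 (ih (mem_sdiff.2 he))

/-- **Both ends of a pair traversed after time `n₀` are visited at a time `≥ n₀`.** [folklore] -/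
theorem exists_pos_eq_of_mem_trav_sdiff {F : Finset (Sym2 (Option V))} {T : Finset (Option V)} {v₀ : Option V}
    {n₀ n : ℕ} {e : Sym2 (Option V)}
    (he : e ∈ (ewIter Eg rk F T (ewInit v₀) n).trav \ (ewIter Eg rk F T (ewInit v₀) n₀).trav) {w : Option V}
    (hw : w ∈ e) : ∃ m, n₀ ≤ m ∧ (ewIter Eg rk F T (ewInit v₀) m).pos = w := by
  induction n with
  | zero =>
    rw [mem_sdiff] at he
    exact absurd (trav_mono_ewIter F T (ewInit v₀) (Nat.zero_le n₀) he.1) he.2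
  | succ n ih =>
    by_cases hle : n + 1 ≤ n₀
    · rw [mem_sdiff] at he
      exact absurd (trav_mono_ewIter F T (ewInit v₀) hle he.1) he.2
    rw [not_le] at hle
    set σ := ewIter Eg rk F T (ewInit v₀) n with hσ
    rw [mem_sdiff, ewIter_succ, ← hσ] at he
    rcases ewStep_cases (E := Eg) (rk := rk) F T σ with ⟨-, hs⟩ | ⟨-, -, hs⟩ | ⟨hh, hT, hA, hs⟩ | ⟨-, -, -, hs⟩
    · rw [hs] at he; exact ih (mem_sdiff.2 he)
    · rw [hs] at he; exact ih (mem_sdiff.2 he)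
    · obtain ⟨hstep, -, hpe, -, -, -⟩ := ewStep_traverse_spec (E := Eg) (rk := rk) hh hT hA
      rw [hstep] at he
      simp only [ewAdvance, mem_insert] at he
      rcases he.1 with rfl | he1
      · rcases (mem_iff_eq_or_eq_edgeOther hpe w).1 hw with rfl | rfl
        · exact ⟨n, Nat.lt_succ_iff.1 hle, rfl⟩
        · refine ⟨n + 1, hle.le, ?_⟩
          rw [ewIter_succ, ← hσ, hstep]; rfl
      · exact ih (mem_sdiff.2 ⟨he1, he.2⟩)
    · rw [hs] at he
      simp only [ewStuck] at he
      exact ih (mem_sdiff.2 he)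

/-- **Characterisation of the outcome (locality)**: let `σ₀` be the state at time `n₀` of the walk
of `F₁` from `v₀`, and `δ` its state at a later time `n ≥ n₀`. An edge set `F` whose pairs among
the ones cancelled at time `n₀` are exactly the traversed ones reaches the state `δ` at time `n`
iff its pairs among the ones cancelled by `δ` are exactly the pairs traversed by `δ`. [cite: AizenmanFernandezJSP1986, §4.2, proof of Prop. 4.4 (b)] -/
theorem ewIter_eq_iff_inter_used (hrk : Set.InjOn rk ↑(Eg)) {F₁ F : Finset (Sym2 (Option V))} {T : Finset (Option V)}
    {v₀ : Option V} {n : ℕ} :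
    ewIter Eg rk F T (ewInit v₀) n = ewIter Eg rk F₁ T (ewInit v₀) n ↔
      F ∩ (ewIter Eg rk F₁ T (ewInit v₀) n).used = (ewIter Eg rk F₁ T (ewInit v₀) n).trav := by
  constructor
  · intro heq
    rw [← heq]
    exact inter_used_eq_trav hrk T (ewInv_init (E := Eg) F v₀) n
  · intro hF
    have hF₁ := inter_used_eq_trav hrk T (ewInv_init (E := Eg) F₁ v₀) n
    refine ewIter_congr hrk (fun e he => ?_) n le_rfl
    constructor
    · intro heF₁
      have : e ∈ F₁ ∩ (ewIter Eg rk F₁ T (ewInit v₀) n).used := mem_inter.2 ⟨heF₁, he⟩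
      rw [hF₁, ← hF] at this
      exact (mem_inter.1 this).1
    · intro heF
      have : e ∈ F ∩ (ewIter Eg rk F₁ T (ewInit v₀) n).used := mem_inter.2 ⟨heF, he⟩
      rw [hF, ← hF₁] at this
      exact (mem_inter.1 this).1

/-- The pairs of `ℰ⁺_Λ` meeting the vertex set `C`. [folklore] -/
def edgesMeeting (C : Finset (Option V)) : Finset (Sym2 (Option V)) := (Eg).filter fun e => ∃ w ∈ C, w ∈ e

/-- Membership in `edgesMeeting`. [folklore] -/
theorem mem_edgesMeeting {C : Finset (Option V)} {e : Sym2 (Option V)} :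
    e ∈ edgesMeeting (G := G) (Λ := Λ) C ↔ e ∈ Eg ∧ ∃ w ∈ C, w ∈ e := by
  simp [edgesMeeting]

/-- The odd vertices of the trail of a walk from `v₀ ∈ Λ ∪ {g}` are `{v₀} ∆ {current vertex}`. [folklore] -/
theorem oddVerts_trav_eq (hrk : Set.InjOn rk ↑(Eg)) (F : Finset (Sym2 (Option V))) (T : Finset (Option V))
    {v₀ : Option V} (hv₀ : v₀ ∈ Λg) (n : ℕ) (hpos : (ewIter Eg rk F T (ewInit v₀) n).pos ∈ Λg) :
    oddVerts Λg (ewIter Eg rk F T (ewInit v₀) n).trav = {v₀} ∆ {(ewIter Eg rk F T (ewInit v₀) n).pos} := by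
  ext p
  have hpar := odd_travDeg_iff hrk (fun e he => not_isDiag_of_mem_edgesIn_ghost (G := G) (Λ := Λ) he) F T v₀ n p
  simp only [travDeg] at hpar
  rw [oddVerts, mem_filter, hpar, mem_symmDiff, mem_singleton, mem_singleton]
  by_cases h1 : p = v₀ <;> by_cases h2 : p = (ewIter Eg rk F T (ewInit v₀) n).pos
  · tauto
  · have hA : p ∈ Λg := h1 ▸ hv₀
    tauto
  · have hA : p ∈ Λg := h2 ▸ hpos
    tauto
  · tauto

/-- **The avoidance bound** (the mechanism of Aizenman–Fernández's Prop. 4.4 (e)–(f),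
eqs. (4.11)–(4.13), combined with Claim (4.15)): fix the state `σ₀` at time `n₀` of the walk of
`F₁` from `v₀` (cancelled pairs `U`, trail `P₀`, position `p₀`), a set `C` of vertices with its
pairs `D`, and an end vertex `q`. For any family `𝓕` of edge sets `F₂ ⊆ ℰ⁺ ∖ U` with odd vertices
`{p₀} ∆ {q}` whose walk (of `P₀ ∪ F₂`, which continues that of `F₁` from `σ₀`) ends at `q` and does
not visit `C` from time `n₀` on,
`(∑_{F₂ ∈ 𝓕} ∏ tanh) · g_{ℰ⁺∖(U∪D)}(∅) ≤ g_{ℰ⁺∖U}(∅) · g_{ℰ⁺∖(U∪D)}({p₀} ∆ {q})`: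
"walks avoiding `C` weigh at most what they weigh in the system deprived of the bonds at `C`". [cite: AizenmanFernandezJSP1986, §4.2, Prop. 4.4 (e)–(f), eqs. (4.11)–(4.15)] -/
theorem sum_tw_avoid_le {θ : Sym2 (Option V) → ℝ} (hθ : ∀ e, 0 ≤ θ e) (hrk : Set.InjOn rk ↑(Eg))
    (F₁ : Finset (Sym2 (Option V))) (T : Finset (Option V)) {v₀ : Option V} (hv₀ : v₀ ∈ Λg) {n₀ : ℕ}
    (hn₀ : n₀ ≤ (Eg).card + 1) (C : Finset (Option V)) {q : Option V} (hq : q ∈ Λg)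
    (hp₀ : (ewIter Eg rk F₁ T (ewInit v₀) n₀).pos ∈ Λg)
    (𝓕 : Finset (Finset (Sym2 (Option V))))
    (h𝓕 : ∀ F₂ ∈ 𝓕, F₂ ⊆ Eg \ (ewIter Eg rk F₁ T (ewInit v₀) n₀).used ∧
      oddVerts Λg F₂ = {(ewIter Eg rk F₁ T (ewInit v₀) n₀).pos} ∆ {q} ∧
      (ewRun Eg rk ((ewIter Eg rk F₁ T (ewInit v₀) n₀).trav ∪ F₂) T v₀).pos = q ∧
      ∀ m, n₀ ≤ m → (ewIter Eg rk ((ewIter Eg rk F₁ T (ewInit v₀) n₀).trav ∪ F₂) T (ewInit v₀) m).pos ∉ C) :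
    (∑ F₂ ∈ 𝓕, tw θ F₂) * gS[θ, Eg \ ((ewIter Eg rk F₁ T (ewInit v₀) n₀).used ∪ edgesMeeting (G := G) (Λ := Λ) C), ∅] ≤
      gS[θ, Eg \ (ewIter Eg rk F₁ T (ewInit v₀) n₀).used, ∅] *
        gS[θ, Eg \ ((ewIter Eg rk F₁ T (ewInit v₀) n₀).used ∪ edgesMeeting (G := G) (Λ := Λ) C),
          {(ewIter Eg rk F₁ T (ewInit v₀) n₀).pos} ∆ {q}] := by
  classical
  set σ₀ := ewIter Eg rk F₁ T (ewInit v₀) n₀ with hσ₀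
  set U := σ₀.used with hU
  set P₀ := σ₀.trav with hP₀
  set p₀ := σ₀.pos with hp₀def
  set D := edgesMeeting (G := G) (Λ := Λ) C with hD
  set B : Finset (Option V) := {p₀} ∆ {q} with hB
  set N := (Eg).card + 1 with hN
  set out : Finset (Sym2 (Option V)) → EWState (Option V) := fun F₂ => ewIter Eg rk (P₀ ∪ F₂) T (ewInit v₀) N with hout
  -- facts about `σ₀`
  have hI₁ : EWInv Eg F₁ σ₀ := ewInv_iter hrk T (ewInv_init (E := Eg) F₁ v₀) n₀
  have hP₀U : P₀ ⊆ U := hI₁.2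
  have hUE : U ⊆ Eg := hI₁.3
  -- for `F₂ ⊆ ℰ⁺ ∖ U`, the walk of `P₀ ∪ F₂` passes through `σ₀` at time `n₀`
  have hpass : ∀ F₂ : Finset (Sym2 (Option V)), F₂ ⊆ Eg \ U → ewIter Eg rk (P₀ ∪ F₂) T (ewInit v₀) n₀ = σ₀ := by
    intro F₂ hF₂
    refine (ewIter_eq_iff_inter_used rk hrk (F₁ := F₁)).2 ?_
    ext e
    simp only [mem_inter, mem_union]
    constructor
    · rintro ⟨he | he, heU⟩
      · exact he
      · exact absurd heU (mem_sdiff.1 (hF₂ he)).2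
    · intro he; exact ⟨Or.inl he, hP₀U he⟩
  -- properties of the outcome of a member of `𝓕`
  have hmem : ∀ F₂ ∈ 𝓕,
      P₀ ⊆ (out F₂).trav ∧ U ⊆ (out F₂).used ∧ (out F₂).pos = q ∧
      F₂ ∩ (out F₂).used = (out F₂).trav \ P₀ ∧
      oddVerts Λg ((out F₂).trav \ P₀) = B ∧
      (out F₂).trav \ P₀ ⊆ Eg \ (U ∪ D) := by
    intro F₂ hF₂
    obtain ⟨hF₂E, hodd, hend, havoid⟩ := h𝓕 F₂ hF₂
    have hp := hpass F₂ hF₂E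
    have htrav : P₀ ⊆ (out F₂).trav := by
      have := trav_mono_ewIter (E := Eg) (rk := rk) (P₀ ∪ F₂) T (ewInit v₀) hn₀
      rw [hp] at this; exact this
    have hused : U ⊆ (out F₂).used := by
      have := used_mono_ewIter (E := Eg) (rk := rk) (P₀ ∪ F₂) T (ewInit v₀) hn₀
      rw [hp] at this; exact this
    have hend' : (out F₂).pos = q := hend
    have hint : (P₀ ∪ F₂) ∩ (out F₂).used = (out F₂).trav :=
      inter_used_eq_trav hrk T (ewInv_init (E := Eg) (P₀ ∪ F₂) v₀) N
    have hQ : F₂ ∩ (out F₂).used = (out F₂).trav \ P₀ := by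
      ext e
      rw [mem_inter, mem_sdiff]
      constructor
      · rintro ⟨heF, heU⟩
        refine ⟨?_, fun heP => (mem_sdiff.1 (hF₂E heF)).2 (hP₀U heP)⟩
        rw [← hint]; exact mem_inter.2 ⟨mem_union_right _ heF, heU⟩
      · rintro ⟨heT, heP⟩
        have : e ∈ (P₀ ∪ F₂) ∩ (out F₂).used := by rw [hint]; exact heT
        rw [mem_inter, mem_union] at this
        exact ⟨this.1.resolve_left heP, this.2⟩
    have hoddQ : oddVerts Λg ((out F₂).trav \ P₀) = B := by
      have hdisj : Disjoint P₀ ((out F₂).trav \ P₀) := disjoint_sdiff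
      have hunion : P₀ ∪ ((out F₂).trav \ P₀) = (out F₂).trav := union_sdiff_of_subset htrav
      have h1 := oddVerts_union_of_disjoint Λg hdisj
      rw [hunion] at h1
      -- `oddVerts trav = {v₀} ∆ {q}`, `oddVerts P₀ = {v₀} ∆ {p₀}`
      have h2 := oddVerts_trav_eq rk hrk (P₀ ∪ F₂) T hv₀ N (by rw [show (ewIter Eg rk (P₀ ∪ F₂) T (ewInit v₀) N).pos = q from hend]; exact hq)
      have h3 := oddVerts_trav_eq rk hrk F₁ T hv₀ n₀ hp₀
      rw [show (ewIter Eg rk (P₀ ∪ F₂) T (ewInit v₀) N) = out F₂ from rfl, hend'] at h2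
      rw [← hσ₀] at h3
      change oddVerts Λg P₀ = {v₀} ∆ {p₀} at h3
      rw [h2, h3] at h1
      -- solve `{v₀} ∆ {q} = ({v₀} ∆ {p₀}) ∆ X` for `X`
      have : oddVerts Λg ((out F₂).trav \ P₀) = ({v₀} ∆ {p₀}) ∆ ({v₀} ∆ {q}) := by
        rw [h1, symmDiff_symmDiff_cancel_left]
      rw [this, hB, symmDiff_comm ({v₀} : Finset (Option V)) {p₀}, symmDiff_assoc, symmDiff_symmDiff_cancel_left]
    have hQsub : (out F₂).trav \ P₀ ⊆ Eg \ (U ∪ D) := by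
      intro e he
      have he' : e ∈ (ewIter Eg rk (P₀ ∪ F₂) T (ewInit v₀) N).trav \ (ewIter Eg rk (P₀ ∪ F₂) T (ewInit v₀) n₀).trav := by
        rw [hp]; exact he
      have h1 := trav_sdiff_subset rk (P₀ ∪ F₂) T v₀ n₀ N he'
      rw [hp] at h1
      rw [mem_sdiff, mem_union, not_or]
      refine ⟨(mem_sdiff.1 h1).1, (mem_sdiff.1 h1).2, fun heD => ?_⟩
      obtain ⟨-, w, hwC, hwe⟩ := mem_edgesMeeting.1 heD
      obtain ⟨m, hm, hpos⟩ := exists_pos_eq_of_mem_trav_sdiff rk he' hwe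
      exact havoid m hm (hpos ▸ hwC)
    exact ⟨htrav, hused, hend', hQ, hoddQ, hQsub⟩
  -- Step 1: decompose `𝓕` along the outcome
  have hstep1 : ∑ F₂ ∈ 𝓕, tw θ F₂ = ∑ δ ∈ 𝓕.image out, ∑ F₂ ∈ 𝓕.filter (fun F₂ => out F₂ = δ), tw θ F₂ :=
    (sum_fiberwise_of_maps_to (fun F₂ hF₂ => mem_image_of_mem out hF₂) _).symm
  -- Step 2: each fibre is bounded by `tw(Q_δ) g_{ℰ⁺∖δ.used}(∅)`
  have hstep2 : ∀ δ ∈ 𝓕.image out,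
      ∑ F₂ ∈ 𝓕.filter (fun F₂ => out F₂ = δ), tw θ F₂ ≤ tw θ (δ.trav \ P₀) * gS[θ, Eg \ δ.used, ∅] := by
    intro δ hδ
    have hfib : ∀ F₂ ∈ 𝓕.filter (fun F₂ => out F₂ = δ), F₂ ∩ δ.used = δ.trav \ P₀ ∧ oddVerts Λg F₂ = B ∧ F₂ ⊆ Eg := by
      intro F₂ hF₂
      obtain ⟨hF₂𝓕, hout⟩ := mem_filter.1 hF₂
      obtain ⟨-, -, -, hQ, -, -⟩ := hmem F₂ hF₂𝓕
      rw [hout] at hQ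
      exact ⟨hQ, (h𝓕 F₂ hF₂𝓕).2.1, (h𝓕 F₂ hF₂𝓕).1.trans sdiff_subset⟩
    obtain ⟨Fw, hFw, hδeq⟩ := mem_image.1 hδ
    obtain ⟨-, -, -, -, hoddQ, -⟩ := hmem Fw hFw
    rw [hδeq] at hoddQ
    -- `tw F₂ = tw Q * tw (F₂ ∖ δ.used)`
    have hsplit : ∀ F₂ ∈ 𝓕.filter (fun F₂ => out F₂ = δ), tw θ F₂ = tw θ (δ.trav \ P₀) * tw θ (F₂ \ δ.used) := by
      intro F₂ hF₂
      obtain ⟨hQ, -, -⟩ := hfib F₂ hF₂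
      rw [← hQ, ← tw_union (disjoint_sdiff_inter F₂ δ.used).symm,
        show F₂ ∩ δ.used ∪ F₂ \ δ.used = F₂ from sup_inf_sdiff F₂ δ.used]
    rw [sum_congr rfl hsplit, ← mul_sum]
    refine mul_le_mul_of_nonneg_left ?_ (tw_nonneg hθ _)
    -- the map `F₂ ↦ F₂ ∖ δ.used` is injective on the fibre and lands in `g_{ℰ⁺∖δ.used}(∅)`
    have hinj : Set.InjOn (fun F₂ : Finset (Sym2 (Option V)) => F₂ \ δ.used) ↑(𝓕.filter (fun F₂ => out F₂ = δ)) := by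
      intro F₂ hF₂ F₂' hF₂' heq
      obtain ⟨hQ, -, -⟩ := hfib F₂ hF₂
      obtain ⟨hQ', -, -⟩ := hfib F₂' hF₂'
      simp only at heq
      calc F₂ = F₂ ∩ δ.used ∪ F₂ \ δ.used := (sup_inf_sdiff F₂ δ.used).symm
        _ = F₂' ∩ δ.used ∪ F₂' \ δ.used := by rw [hQ, hQ', heq]
        _ = F₂' := sup_inf_sdiff F₂' δ.used
    rw [← sum_image hinj, ghteSum_eq_sum_tw]
    refine sum_le_sum_of_subset_of_nonneg (fun F₃ hF₃ => ?_) fun F _ _ => tw_nonneg hθ F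
    obtain ⟨F₂, hF₂, rfl⟩ := mem_image.1 hF₃
    obtain ⟨hQ, hodd, hF₂E⟩ := hfib F₂ hF₂
    rw [mem_filter, mem_powerset]
    refine ⟨sdiff_subset_sdiff hF₂E subset_rfl, ?_⟩
    -- `oddVerts (F₂ ∖ δ.used) = B ∆ B = ∅`
    have hdisj : Disjoint (F₂ ∩ δ.used) (F₂ \ δ.used) := (disjoint_sdiff_inter F₂ δ.used).symm
    have hunion : (F₂ ∩ δ.used) ∪ (F₂ \ δ.used) = F₂ := sup_inf_sdiff _ _
    have h1 := oddVerts_union_of_disjoint Λg hdisj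
    rw [hunion, hodd, hQ, hoddQ] at h1
    have : oddVerts Λg (F₂ \ δ.used) = B ∆ (B ∆ oddVerts Λg (F₂ \ δ.used)) :=
      (symmDiff_symmDiff_cancel_left _ _).symm
    rw [← h1] at this
    rw [this, symmDiff_self]
    rfl
  -- facts about realised outcomes `δ`
  have hδ : ∀ δ ∈ 𝓕.image out, P₀ ⊆ δ.trav ∧ U ⊆ δ.used ∧ δ.trav ⊆ δ.used ∧
      oddVerts Λg (δ.trav \ P₀) = B ∧ δ.trav \ P₀ ⊆ Eg \ (U ∪ D) ∧
      ∀ X' : Finset (Sym2 (Option V)), X' ∩ δ.used = δ.trav \ P₀ → ewIter Eg rk (P₀ ∪ X') T (ewInit v₀) N = δ := by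
    intro δ hδ
    obtain ⟨Fw, hFw, hδeq⟩ := mem_image.1 hδ
    obtain ⟨htrav, hused, -, hQ, hoddQ, hQsub⟩ := hmem Fw hFw
    have hI : EWInv Eg (P₀ ∪ Fw) (out Fw) := ewInv_iter hrk T (ewInv_init (E := Eg) (P₀ ∪ Fw) v₀) N
    rw [hδeq] at htrav hused hQ hoddQ hQsub hI
    refine ⟨htrav, hused, hI.2, hoddQ, hQsub, fun X' hX' => ?_⟩
    rw [← hδeq]
    refine (ewIter_eq_iff_inter_used rk hrk (F₁ := P₀ ∪ Fw)).2 ?_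
    rw [show ewIter Eg rk (P₀ ∪ Fw) T (ewInit v₀) N = δ from hδeq]
    ext e
    simp only [mem_inter, mem_union]
    constructor
    · rintro ⟨he | he, heU⟩
      · exact htrav he
      · have : e ∈ X' ∩ δ.used := mem_inter.2 ⟨he, heU⟩
        rw [hX'] at this
        exact (mem_sdiff.1 this).1
    · intro he
      refine ⟨?_, hI.2 he⟩
      by_cases heP : e ∈ P₀
      · exact Or.inl heP
      · right
        have : e ∈ X' ∩ δ.used := by rw [hX']; exact mem_sdiff.2 ⟨he, heP⟩
        exact (mem_inter.1 this).1
  -- Step 3: supermodularity, fibre by fibre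
  have hstep3 : ∀ δ ∈ 𝓕.image out,
      tw θ (δ.trav \ P₀) * gS[θ, Eg \ δ.used, ∅] * gS[θ, Eg \ (U ∪ D), ∅] ≤
        gS[θ, Eg \ U, ∅] * (tw θ (δ.trav \ P₀) * gS[θ, Eg \ (δ.used ∪ D), ∅]) := by
    intro δ hδ'
    obtain ⟨-, hUδ, -, -, -, -⟩ := hδ δ hδ'
    have hsm := ghteSum_empty_supermodular hθ (X := Eg \ U) sdiff_subset δ.used D
    have e1 : (Eg \ U) \ δ.used = Eg \ δ.used := by
      ext e; simp only [mem_sdiff]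
      exact ⟨fun h => ⟨h.1.1, h.2⟩, fun h => ⟨⟨h.1, fun hU' => h.2 (hUδ hU')⟩, h.2⟩⟩
    have e2 : (Eg \ U) \ D = Eg \ (U ∪ D) := by
      ext e; simp only [mem_sdiff, mem_union]; tauto
    have e3 : (Eg \ U) \ (δ.used ∪ D) = Eg \ (δ.used ∪ D) := by
      ext e; simp only [mem_sdiff, mem_union]
      constructor
      · rintro ⟨⟨hE, -⟩, h⟩; exact ⟨hE, h⟩
      · rintro ⟨hE, h⟩; exact ⟨⟨hE, fun hU' => h (Or.inl (hUδ hU'))⟩, h⟩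
    rw [e1, e2, e3] at hsm
    have ht := tw_nonneg hθ (δ.trav \ P₀)
    nlinarith [mul_le_mul_of_nonneg_left hsm ht]
  -- Step 4: regrouping in the system deprived of `U ∪ D`
  have hstep4 : ∑ δ ∈ 𝓕.image out, tw θ (δ.trav \ P₀) * gS[θ, Eg \ (δ.used ∪ D), ∅] ≤ gS[θ, Eg \ (U ∪ D), B] := by
    set I := 𝓕.image out with hI
    set S : EWState (Option V) → Finset (Finset (Sym2 (Option V))) :=
      fun δ => (Eg \ (δ.used ∪ D)).powerset.filter (fun F₃ => oddVerts Λg F₃ = ∅) with hS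
    set Φ : (Σ _ : EWState (Option V), Finset (Sym2 (Option V))) → Finset (Sym2 (Option V)) :=
      fun x => (x.1.trav \ P₀) ∪ x.2 with hΦ
    have hmemS : ∀ x ∈ I.sigma S, x.1 ∈ I ∧ x.2 ⊆ Eg \ (x.1.used ∪ D) ∧ oddVerts Λg x.2 = ∅ := by
      intro x hx
      rw [mem_sigma] at hx
      obtain ⟨h1, h2⟩ := hx
      rw [mem_filter, mem_powerset] at h2
      exact ⟨h1, h2.1, h2.2⟩
    have hdisj : ∀ x ∈ I.sigma S, Disjoint (x.1.trav \ P₀) x.2 := by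
      intro x hx
      obtain ⟨h1, h2, -⟩ := hmemS x hx
      obtain ⟨-, -, htu, -, -, -⟩ := hδ x.1 h1
      rw [Finset.disjoint_left]
      intro e he he2
      exact (mem_sdiff.1 (h2 he2)).2 (mem_union_left _ (htu (mem_sdiff.1 he).1))
    -- rewrite the left side as a sum over the sigma type
    have hL : ∑ δ ∈ I, tw θ (δ.trav \ P₀) * gS[θ, Eg \ (δ.used ∪ D), ∅] = ∑ x ∈ I.sigma S, tw θ (Φ x) := by
      rw [sum_sigma]
      refine sum_congr rfl fun δ hδI => ?_
      rw [ghteSum_eq_sum_tw, mul_sum]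
      refine sum_congr rfl fun F₃ hF₃ => ?_
      have hx : (⟨δ, F₃⟩ : Σ _ : EWState (Option V), Finset (Sym2 (Option V))) ∈ I.sigma S := mem_sigma.2 ⟨hδI, hF₃⟩
      rw [hΦ]
      simp only
      rw [tw_union (hdisj _ hx)]
    -- `Φ` is injective on the sigma set
    have hinj : Set.InjOn Φ ↑(I.sigma S) := by
      intro x hx y hy hxy
      obtain ⟨hx1, hx2, -⟩ := hmemS x hx
      obtain ⟨hy1, hy2, -⟩ := hmemS y hy
      obtain ⟨-, -, htux, -, -, hGLx⟩ := hδ x.1 hx1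
      obtain ⟨-, -, htuy, -, -, hGLy⟩ := hδ y.1 hy1
      simp only [hΦ] at hxy
      -- both outcomes are the outcome of `P₀ ∪ Φ x`
      have hXx : Φ x ∩ x.1.used = x.1.trav \ P₀ := by
        simp only [hΦ]
        ext e; simp only [mem_inter, mem_union, mem_sdiff]
        constructor
        · rintro ⟨⟨he, heP⟩ | he, heU⟩
          · exact ⟨he, heP⟩
          · exact absurd heU fun h => (mem_sdiff.1 (hx2 he)).2 (mem_union_left _ h)
        · rintro ⟨he, heP⟩; exact ⟨Or.inl ⟨he, heP⟩, htux he⟩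
      have hXy : Φ y ∩ y.1.used = y.1.trav \ P₀ := by
        simp only [hΦ]
        ext e; simp only [mem_inter, mem_union, mem_sdiff]
        constructor
        · rintro ⟨⟨he, heP⟩ | he, heU⟩
          · exact ⟨he, heP⟩
          · exact absurd heU fun h => (mem_sdiff.1 (hy2 he)).2 (mem_union_left _ h)
        · rintro ⟨he, heP⟩; exact ⟨Or.inl ⟨he, heP⟩, htuy he⟩
      have h1 := hGLx (Φ x) hXx
      have h2 := hGLy (Φ y) hXy
      have hΦxy : Φ x = Φ y := hxy
      rw [hΦxy] at h1
      have hδδ : x.1 = y.1 := h1.symm.trans h2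
      -- then the second components agree
      have h3 : x.2 = Φ x \ x.1.used := by
        simp only [hΦ]
        ext e; simp only [mem_sdiff, mem_union]
        constructor
        · intro he; exact ⟨Or.inr he, fun h => (mem_sdiff.1 (hx2 he)).2 (mem_union_left _ h)⟩
        · rintro ⟨⟨he, -⟩ | he, heU⟩
          · exact absurd (htux he) heU
          · exact he
      have h4 : y.2 = Φ y \ y.1.used := by
        simp only [hΦ]
        ext e; simp only [mem_sdiff, mem_union]
        constructor
        · intro he; exact ⟨Or.inr he, fun h => (mem_sdiff.1 (hy2 he)).2 (mem_union_left _ h)⟩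
        · rintro ⟨⟨he, -⟩ | he, heU⟩
          · exact absurd (htuy he) heU
          · exact he
      have h22 : x.2 = y.2 := by rw [h3, h4, hΦxy, hδδ]
      exact Sigma.ext hδδ (heq_of_eq h22)
    rw [hL, ← sum_image hinj, ghteSum_eq_sum_tw]
    refine sum_le_sum_of_subset_of_nonneg (fun F' hF' => ?_) fun F _ _ => tw_nonneg hθ F
    obtain ⟨x, hx, rfl⟩ := mem_image.1 hF'
    obtain ⟨hx1, hx2, hx3⟩ := hmemS x (mem_coe.1 hx)
    obtain ⟨-, hUδ, -, hoddQ, hQsub, -⟩ := hδ x.1 hx1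
    rw [mem_filter, mem_powerset]
    refine ⟨union_subset hQsub (hx2.trans (sdiff_subset_sdiff subset_rfl (union_subset_union hUδ subset_rfl))), ?_⟩
    rw [hΦ]
    simp only
    rw [oddVerts_union_of_disjoint Λg (hdisj x (mem_coe.1 hx)), hoddQ, hx3]
    exact symmDiff_bot B
  -- combine
  have hg0 : 0 ≤ gS[θ, Eg \ (U ∪ D), ∅] := ghteSum_nonneg hθ _ _
  have hgU : 0 ≤ gS[θ, Eg \ U, ∅] := ghteSum_nonneg hθ _ _
  calc (∑ F₂ ∈ 𝓕, tw θ F₂) * gS[θ, Eg \ (U ∪ D), ∅]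
      = ∑ δ ∈ 𝓕.image out, (∑ F₂ ∈ 𝓕.filter (fun F₂ => out F₂ = δ), tw θ F₂) * gS[θ, Eg \ (U ∪ D), ∅] := by
        rw [hstep1, sum_mul]
    _ ≤ ∑ δ ∈ 𝓕.image out, tw θ (δ.trav \ P₀) * gS[θ, Eg \ δ.used, ∅] * gS[θ, Eg \ (U ∪ D), ∅] :=
        sum_le_sum fun δ hδ' => mul_le_mul_of_nonneg_right (hstep2 δ hδ') hg0
    _ ≤ ∑ δ ∈ 𝓕.image out, gS[θ, Eg \ U, ∅] * (tw θ (δ.trav \ P₀) * gS[θ, Eg \ (δ.used ∪ D), ∅]) :=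
        sum_le_sum fun δ hδ' => hstep3 δ hδ'
    _ = gS[θ, Eg \ U, ∅] * ∑ δ ∈ 𝓕.image out, tw θ (δ.trav \ P₀) * gS[θ, Eg \ (δ.used ∪ D), ∅] := by
        rw [mul_sum]
    _ ≤ gS[θ, Eg \ U, ∅] * gS[θ, Eg \ (U ∪ D), B] := mul_le_mul_of_nonneg_left hstep4 hgU

/-! ## Part C. The kernel `K(v,k)` and the right half of (4.22) -/

/-- Once at a stopping vertex, the walk stays there. [folklore] -/
theorem ewIter_pos_eq_of_mem {F : Finset (Sym2 (Option V))} {T : Finset (Option V)} {σ₀ : EWState (Option V)}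
    {n : ℕ} (h : (ewIter Eg rk F T σ₀ n).pos ∈ T) {m : ℕ} (hm : n ≤ m) :
    (ewIter Eg rk F T σ₀ m).pos = (ewIter Eg rk F T σ₀ n).pos := by
  induction hm with
  | refl => rfl
  | step hle ih =>
    rw [ewIter_succ]
    set σ := ewIter Eg rk F T σ₀ _ with hσ
    rw [← ih]
    rw [← ih] at h
    by_cases hh : σ.halt = true
    · rw [ewStep_of_halt hh]
    · rw [Bool.not_eq_true] at hh
      rw [ewStep_of_mem hh h]

variable (G Λ) in
/-- **The backbone kernel `K(v,k)`** (Aizenman–Fernández 1986, Definition 4.5, eq. (4.16), in the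
high-temperature picture): the normalised weight `∑ ∏ tanh θ_e / g(∅)` of the edge sets
`F ⊆ ℰ⁺_Λ` with odd vertices `{v,k}` whose backbone from `v` (stopping set `{k, g}`) ends at `k`
— "`k` is the first site reached", i.e. the walk reaches `k` without touching the ghost. For `k = v`
the empty set contributes and `K(v,v) = P(ω = ∅…) `; we only use `0 ≤ K ≤ ⟨σ_vσ_k⟩_{h=0}`. [cite: AizenmanFernandezJSP1986, §4.3, Definition 4.5, eq. (4.16)] -/
def bbKernel (θ : Sym2 (Option V) → ℝ) (v k : V) : ℝ :=
  (∑ F ∈ (Eg).powerset with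
      (oddVerts Λg F = ({some v} ∆ {some k} : Finset (Option V)) ∧
        (ewRun Eg rk F {some k, none} (some v)).pos = some k), tw θ F) / gS[θ, Eg, ∅]

/-- `K(v,k) ≥ 0`. [folklore] -/
theorem bbKernel_nonneg {θ : Sym2 (Option V) → ℝ} (hθ : ∀ e, 0 ≤ θ e) (v k : V) : 0 ≤ bbKernel G Λ rk θ v k :=
  div_nonneg (sum_nonneg fun F _ => tw_nonneg hθ F) (ghteSum_nonneg hθ _ _)

/-- The switched-off couplings `cplOff θ (edgesMeeting {g})` agree with `zeroField θ` on `ℰ⁺_Λ`. [folklore] -/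
theorem cplOff_edgesMeeting_none_eq (θ : Sym2 (Option V) → ℝ) :
    ∀ e ∈ Eg, cplOff θ (edgesMeeting (G := G) (Λ := Λ) {none}) e = zeroField θ e := by
  intro e he
  unfold cplOff zeroField
  by_cases hn : (none : Option V) ∈ e
  · rw [if_pos (mem_edgesMeeting.2 ⟨he, none, mem_singleton_self _, hn⟩), if_pos hn]
  · rw [if_neg (fun h => hn (by obtain ⟨-, w, hw, hwe⟩ := mem_edgesMeeting.1 h; rwa [mem_singleton.1 hw] at hwe)),
      if_neg hn]

/-- **Proposition 4.7, right half of (4.22)**: `K(v,k) ≤ ⟨σ_vσ_k⟩_{h=0}` — the backbones from `v`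
reaching `k` before the ghost avoid the ghost, so (avoidance bound with `C = {g}`) they weigh at
most `g_{h=0}({v,k})/g_{h=0}(∅)`. [cite: AizenmanFernandezJSP1986, §4.3, Prop. 4.7, eq. (4.22)] -/
theorem bbKernel_le_thetaCorr_zeroField {θ : Sym2 (Option V) → ℝ} (hθ : ∀ e, 0 ≤ θ e) (hrk : Set.InjOn rk ↑(Eg))
    {v k : V} (hv : v ∈ Λ) (hk : k ∈ Λ) :
    bbKernel G Λ rk θ v k ≤ thetaCorr G Λ (zeroField θ) ({v} ∆ {k}) := by
  classical
  set T : Finset (Option V) := {some k, none} with hT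
  set 𝓕 := (Eg).powerset.filter (fun F => oddVerts Λg F = ({some v} ∆ {some k} : Finset (Option V)) ∧
      (ewRun Eg rk F T (some v)).pos = some k) with h𝓕
  have hvg : (some v : Option V) ∈ Λg := Finset.some_mem_insertNone.2 hv
  have hkg : (some k : Option V) ∈ Λg := Finset.some_mem_insertNone.2 hk
  -- the avoidance bound from the initial state (`n₀ = 0`, `U = P₀ = ∅`), `C = {g}`, `q = k`
  have key := sum_tw_avoid_le rk hθ hrk ∅ T hvg (Nat.zero_le _) ({none} : Finset (Option V)) hkg
    (by exact hvg) 𝓕 ?_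
  · change (∑ F₂ ∈ 𝓕, tw θ F₂) * gS[θ, Eg \ (∅ ∪ edgesMeeting (G := G) (Λ := Λ) {none}), ∅] ≤
      gS[θ, Eg \ ∅, ∅] * gS[θ, Eg \ (∅ ∪ edgesMeeting (G := G) (Λ := Λ) {none}), {some v} ∆ {some k}] at key
    rw [empty_union, sdiff_empty] at key
    have hDE : edgesMeeting (G := G) (Λ := Λ) {none} ⊆ Eg := filter_subset _ _
    have h0 := ghteSum_empty_pos (Λ := Λ) hθ (Eg \ edgesMeeting (G := G) (Λ := Λ) {none})
    have h1 := ghteSum_empty_pos (Λ := Λ) hθ (Eg)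
    rw [bbKernel, ← thetaCorr_congr (cplOff_edgesMeeting_none_eq θ),
      show edgesMeeting (G := G) (Λ := Λ) {none} = Eg \ (Eg \ edgesMeeting (G := G) (Λ := Λ) {none}) from
        (Finset.sdiff_sdiff_eq_self hDE).symm,
      thetaCorr_cplOff_sdiff_eq_ghteSum_div θ sdiff_subset
        (symmDiff_le_sup.trans (sup_le (singleton_subset_iff.2 hv) (singleton_subset_iff.2 hk))),
      starSet_pair, div_le_div_iff₀ h1 h0]
    rw [mul_comm (gS[θ, Eg, ∅])] at key
    exact key
  · intro F hF
    rw [h𝓕, mem_filter, mem_powerset] at hF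
    obtain ⟨hFE, hodd, hend⟩ := hF
    refine ⟨?_, hodd, ?_, fun m _ hm => ?_⟩
    · show F ⊆ Eg \ ∅
      rw [sdiff_empty]; exact hFE
    · show (ewRun Eg rk (∅ ∪ F) T (some v)).pos = some k
      rw [empty_union]; exact hend
    · change (ewIter Eg rk (∅ ∪ F) T (ewInit (some v)) m).pos ∈ ({none} : Finset (Option V)) at hm
      rw [empty_union, mem_singleton] at hm
      -- a walk that touches the ghost stays there, but this one ends at `k`
      have hstay := ewIter_pos_eq_of_mem rk (F := F) (T := T) (σ₀ := ewInit (some v)) (n := m)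
        (by rw [hm, hT]; simp) (le_max_left m ((Eg).card + 1))
      have hfin : (ewIter Eg rk F T (ewInit (some v)) (max m ((Eg).card + 1))).pos = some k := by
        rw [ewIter_eq_ewRun_of_le hrk F T (some v) (le_max_right _ _)]; exact hend
      rw [hfin, hm] at hstay
      exact Option.some_ne_none k hstay

end Backbone

end Literature.Probability.LatticeModels
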